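import Literature.AlgebraicGeometry.Motives.AbelianVarietyWeilPairingAlternating
import Literature.AlgebraicGeometry.Motives.AbelianVarietyEndGaloisDescent
import Literature.AlgebraicGeometry.Motives.CyclesDimensionFunctionField
import HarnessLib

/-!
# Galois equivariance of the level Weil pairing on `P_L` (Milne 1986, §16; Lang VII §2)

Let `P` be an abelian variety over a field `K`, `L / K` a field extension, `Y = P_L = P ×_K Spec L`
(`AbelianVariety.baseChange`), and `Θ` a Cartier divisor on `Y` which is **Galois invariant** in the
sense that `(1 × Spec τ⁻¹)^* Θ` is the same divisor as `Θ` for all `τ ∈ Aut(L/K)` — e.g. the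
pullback `pr₁^* Θ₀` of a divisor `Θ₀` of `P` (`pullback_fstX_galX_sameDivisor`). For
`σ ∈ Aut(L/K)` and `L`-points `r, s ∈ P(L)` with `r^N = s^N = 1` (points of `P_L(L)` through
`AbelianVariety.pointsMulEquiv`), the level-`N` Weil pairing of
`Motives/AbelianVarietyWeilPairingLevel` satisfies

  `ē_N^Θ(σ r, σ s) = σ (ē_N^Θ(r, s))`          (`weilPairingLevel_galSmul`).

This is the statement that the pairings `ē_m` are pairings of `Gal(K̄/K)`-modules: Milne, *Abelian
varieties* (1986), §16, p. 131 (the `ē_m : A_m(k̄) × A^∨_m(k̄) → μ_m(k̄)` of a polarization defined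
over `k` are Galois equivariant, which is what makes `e_l^λ` a pairing of `Gal`-modules
`T_l A × T_l A → ℤ_l(1)`), Lang, *Abelian Varieties*, VII §2 (the pairing is defined over `k`),
Mumford §20 — the property `smul_eq` consumed by the passage to the Tate module
(`Literature.NumberTheory.DiophantineGeometry.LevelWeilPairing`).

## Proof (transport of structure along `gal σ = 1 × Spec σ⁻¹`)

Everything entering `ē_N^Θ(r, s) = t_r^♯ g_s / g_s` (`[N]^*(t_s^* Θ - Θ) + div g_s = 0`) is
transported along the `K`-automorphism `gal σ` of the scheme `Y`
(`Motives/AbelianVarietyQuotientAction`; here `galX σ`, the same morphism typed on `(P_L).X.left`):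

* `translation_smul_left` — **`t_{σ s} = gal σ⁻¹ ≫ t_s ≫ gal σ`** (the conjugation rule `gal_transl`);
* `galX_comp_zsmul` — `gal σ` commutes with `[N]_{P_L} = ([N]_P)_L`;
* `functionFieldMap_galX_algebraMap` — on constants `L ⊆ K(Y)`, `(gal σ)^♯ c = σ⁻¹ c`;
* `IsTrivializer.gal` — `(gal τ)^♯ g` trivializes `[N]^* (gal τ)^* E` when `g` trivializes `[N]^* E`;
* `weilDiv_smul_sameDivisor` — `D_{σ s} = (gal σ⁻¹)^* D_s` as divisors (`Θ` being invariant);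
* hence `ē(σ r, σ s) = (gal σ⁻¹)^♯ (t_r^♯ g_s / g_s) = (gal σ⁻¹)^♯ ē(r, s) = σ (ē(r, s))`.

Everything is proved; no named facts (D-0026). The only definitions are the reducible synonyms
`galX`, `fstX` (the morphisms `gal σ`, `pr₁` typed on `(P.baseChange L).X.left`, so that the
integral-scheme instances of abelian varieties are found) and `torsionPt`. Towards the named fact
`Literature.NumberTheory.DiophantineGeometry.weilPairing_rationalTateModule`.

## References

* [Milne1986AbelianVarieties] J. S. Milne, *Abelian varieties*, in Cornell–Silverman (eds.),
  *Arithmetic Geometry* (1986), §16, p. 131 (the pairings `ē_m`; PDF p. 198).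
* [Lang1983AbelianVarieties] S. Lang, *Abelian Varieties*, Ch. VII §2 (PDF pp. 138–142).
* [MumfordAV1970] D. Mumford, *Abelian Varieties* (1970), §20.
-/

universe u

open CategoryTheory CategoryTheory.Limits AlgebraicGeometry MonoidalCategory CartesianMonoidalCategory

noncomputable section

namespace Literature.AlgebraicGeometry.Motives

open scoped MonObj
open RatFn

namespace AbelianVariety

variable {K : Type u} [Field K] (L : Type u) [Field L] [Algebra K L] (P : AbelianVariety K)

/-! ### `gal σ` and `pr₁` typed on `(P_L).X.left` -/

/-- The Galois automorphism `gal σ = 1 × Spec σ⁻¹` of `P_L` (`Motives/AbelianVarietyQuotientAction`),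
as an endomorphism of the scheme `(P.baseChange L).X.left` (the same morphism: that scheme *is*
`P ×_K Spec L`; the synonym lets instance search find the abelian-variety instances). [folklore] -/
abbrev galX (σ : L ≃ₐ[K] L) : (P.baseChange L).X.left ⟶ (P.baseChange L).X.left := P.gal L σ

/-- The projection `pr₁ : P_L → P`, typed on `(P.baseChange L).X.left`. [folklore] -/
abbrev fstX : (P.baseChange L).X.left ⟶ P.X.left := pullback.fst P.X.hom (bcSpec K L)

/-- `gal σ ≫ gal σ⁻¹ = 𝟙`. [folklore] -/
@[reassoc]
theorem galX_comp_galX_symm (σ : L ≃ₐ[K] L) : P.galX L σ ≫ P.galX L σ⁻¹ = 𝟙 _ :=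
  P.gal_comp_gal_symm L σ

/-- `gal σ⁻¹ ≫ gal σ = 𝟙`. [folklore] -/
@[reassoc]
theorem galX_symm_comp_galX (σ : L ≃ₐ[K] L) : P.galX L σ⁻¹ ≫ P.galX L σ = 𝟙 _ :=
  P.gal_symm_comp_gal L σ

/-- `gal σ` is an isomorphism of schemes (inverse `gal σ⁻¹`). [folklore] -/
instance isIso_galX (σ : L ≃ₐ[K] L) : IsIso (P.galX L σ) :=
  ⟨⟨P.galX L σ⁻¹, P.galX_comp_galX_symm L σ, P.galX_symm_comp_galX L σ⟩⟩

/-- `gal σ` is dominant. [folklore] -/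
instance isDominant_galX (σ : L ≃ₐ[K] L) : IsDominant (P.galX L σ) := inferInstance

/-- `pr₁ : P_L → P` is surjective (base change of `Spec L → Spec K`). [folklore] -/
instance surjective_fstX : Surjective (P.fstX L) := P.surjective_fst' L

/-- `pr₁ : P_L → P` is dominant. [folklore] -/
instance isDominant_fstX : IsDominant (P.fstX L) := ⟨(P.surjective_fstX L).1.denseRange⟩

/-- `pr₁ : P_L → P` is an affine morphism (base change of the affine `Spec L → Spec K`). [folklore] -/
instance isAffineHom_fstX : IsAffineHom (P.fstX L) :=
  MorphismProperty.pullback_fst (P := @IsAffineHom) _ _ inferInstance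

/-- `gal σ ≫ pr₁ = pr₁`. [folklore] -/
@[reassoc]
theorem galX_fstX (σ : L ≃ₐ[K] L) : P.galX L σ ≫ P.fstX L = P.fstX L := P.gal_fst L σ

/-- **`gal σ` commutes with `[n]_{P_L}`** (`[n]_{P_L} = ([n]_P)_L` is defined over `K`;
`gal_comp_toSchemeHom_baseChange`). [folklore] -/
@[reassoc]
theorem galX_comp_zsmul (σ : L ≃ₐ[K] L) (n : ℤ) :
    P.galX L σ ≫ Hom.toSchemeHom (n • 𝟙 (P.baseChange L)) =
      Hom.toSchemeHom (n • 𝟙 (P.baseChange L)) ≫ P.galX L σ := by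
  rw [← baseChange_zsmul_id]
  exact P.gal_comp_toSchemeHom_baseChange L σ (n • 𝟙 P)

/-- **`t_{σ • s} = gal σ⁻¹ ≫ t_s ≫ gal σ`** — the translation of `P_L` by a Galois-conjugate point is
the Galois conjugate of the translation (`gal_transl`). [folklore] -/
theorem translation_smul_left (σ : L ≃ₐ[K] L) (s : P.Points L) :
    ((P.baseChange L).translation (P.pointsMulEquiv L (σ • s))).left =
      P.galX L σ⁻¹ ≫ ((P.baseChange L).translation (P.pointsMulEquiv L s)).left ≫ P.galX L σ := by
  have h := P.gal_transl L σ⁻¹ s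
  rw [inv_inv] at h
  change P.transl L (σ • s) = P.gal L σ⁻¹ ≫ P.transl L s ≫ P.gal L σ
  rw [← Category.assoc, h, Category.assoc, gal_symm_comp_gal, Category.comp_id]

/-! ### `gal σ` on the function field: constants are moved by `σ⁻¹` -/

/-- **`(gal σ)^♯ c = σ⁻¹ c` on constants `c ∈ L ⊆ K(P_L)`**: `gal σ = 1 × Spec σ⁻¹` covers
`Spec σ⁻¹` on the base (`gal_snd`), and the `L`-algebra structure of `K(P_L)` is
`L = Γ(Spec L) → Γ(P_L, 𝒪) → K(P_L)` along `pr₂`. [folklore] -/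
theorem functionFieldMap_galX_algebraMap (σ : L ≃ₐ[K] L) (c : L) :
    functionFieldMap (P.galX L σ) (algebraMap L (P.baseChange L).X.left.functionField c) =
      algebraMap L (P.baseChange L).X.left.functionField (σ⁻¹ c) := by
  rw [algebraMap_stalk_apply, algebraMap_stalk_apply]
  have hcomp : P.galX L σ ≫ ((P.baseChange L).X.left ↘ Spec (.of L)) =
      ((P.baseChange L).X.left ↘ Spec (.of L)) ≫
        Spec.map (CommRingCat.ofHom ((σ⁻¹ : L ≃ₐ[K] L) : L →+* L)) :=
    P.gal_snd L σ
  rw [functionFieldMap_algebraMap_top ((P.baseChange L).X.left ↘ Spec (.of L)) (P.galX L σ) _ rfl c,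
    hcomp, Scheme.Hom.comp_appTop, CommRingCat.comp_apply]
  congr 2
  have h := congrArg (fun φ => φ.hom c)
    (Scheme.ΓSpecIso_inv_naturality (CommRingCat.ofHom ((σ⁻¹ : L ≃ₐ[K] L) : L →+* L)))
  simp only [CommRingCat.hom_comp, RingHom.coe_comp, Function.comp_apply, CommRingCat.hom_ofHom] at h
  exact h.symm

/-! ### Transport of trivializers and of the Weil divisor along `gal` -/

section Level

variable {N : ℕ} [IsDominant (Hom.toSchemeHom ((N : ℤ) • 𝟙 (P.baseChange L)))]

/-- **`(gal τ)^♯ g` trivializes `[N]^* (gal τ)^* E` if `g` trivializes `[N]^* E`** (`gal τ` commutes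
with `[N]`). [folklore] -/
theorem IsTrivializer.gal {E : CartierDivisor (P.baseChange L).X.left}
    {g : (P.baseChange L).X.left.functionField}
    (hg : (P.baseChange L).IsTrivializer (n := N) E g) (τ : L ≃ₐ[K] L) :
    (P.baseChange L).IsTrivializer (n := N) (E.pullback (P.galX L τ))
      (functionFieldMap (P.galX L τ) g) := by
  refine ⟨(map_ne_zero _).2 hg.1, fun i x hi => ?_⟩
  have hcomm := P.galX_comp_zsmul L τ (N : ℤ)
  have hi' : Hom.toSchemeHom ((N : ℤ) • 𝟙 (P.baseChange L)) ((P.galX L τ) x) ∈ E.U i := by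
    rw [← Scheme.Hom.comp_apply, hcomm, Scheme.Hom.comp_apply]
    exact hi
  have h1 : IsUnitAt x (functionFieldMap (P.galX L τ)
      (functionFieldMap (Hom.toSchemeHom ((N : ℤ) • 𝟙 (P.baseChange L))) (E.f i) * g)) :=
    (hg.2 i _ hi').functionFieldMap
  rw [map_mul] at h1
  haveI : IsDominant (P.galX L τ ≫ Hom.toSchemeHom ((N : ℤ) • 𝟙 (P.baseChange L))) := inferInstance
  haveI : IsDominant (Hom.toSchemeHom ((N : ℤ) • 𝟙 (P.baseChange L)) ≫ P.galX L τ) := inferInstance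
  have h2 := functionFieldMap_comp (Hom.toSchemeHom ((N : ℤ) • 𝟙 (P.baseChange L))) (P.galX L τ)
  have h3 := functionFieldMap_comp (P.galX L τ) (Hom.toSchemeHom ((N : ℤ) • 𝟙 (P.baseChange L)))
  have h4 : functionFieldMap (P.galX L τ ≫ Hom.toSchemeHom ((N : ℤ) • 𝟙 (P.baseChange L))) =
      functionFieldMap (Hom.toSchemeHom ((N : ℤ) • 𝟙 (P.baseChange L)) ≫ P.galX L τ) :=
    functionFieldMap_congr hcomm
  rw [h2, h3] at h4
  have h5 := congrArg (fun φ => φ (E.f i)) h4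
  simp only [RingHom.coe_comp, Function.comp_apply] at h5
  convert h1 using 2
  rw [CartierDivisor.pullback_f]
  exact h5.symm

end Level

/-- **`D_{σ s} = (gal σ⁻¹)^* D_s`** as divisors, for a Galois-invariant `Θ`: `t_{σ s}^* Θ - Θ =
(gal σ⁻¹ ≫ t_s ≫ gal σ)^* Θ - Θ = (gal σ⁻¹)^* (t_s^* Θ - Θ)` using `(gal σ)^* Θ = Θ` twice.
[folklore] -/
theorem weilDiv_smul_sameDivisor (Θ : CartierDivisor (P.baseChange L).X.left)
    (hΘ : ∀ τ : L ≃ₐ[K] L, (Θ.pullback (P.galX L τ)).SameDivisor Θ) (σ : L ≃ₐ[K] L)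
    (s : P.Points L) :
    ((P.baseChange L).weilDiv Θ (P.pointsMulEquiv L (σ • s))).SameDivisor
      (((P.baseChange L).weilDiv Θ (P.pointsMulEquiv L s)).pullback (P.galX L σ⁻¹)) := by
  have ht := P.translation_smul_left L σ s
  haveI : IsDominant (((P.baseChange L).translation (P.pointsMulEquiv L s)).left ≫ P.galX L σ) :=
    inferInstance
  haveI : IsDominant (P.galX L σ⁻¹ ≫
      ((P.baseChange L).translation (P.pointsMulEquiv L s)).left ≫ P.galX L σ) := inferInstance
  -- `t_{σ s}^* Θ = (gal σ⁻¹)^* t_s^* (gal σ)^* Θ ~ (gal σ⁻¹)^* t_s^* Θ`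
  have h1 : (Θ.pullback ((P.baseChange L).translation (P.pointsMulEquiv L (σ • s))).left).SameDivisor
      ((Θ.pullback ((P.baseChange L).translation (P.pointsMulEquiv L s)).left).pullback
        (P.galX L σ⁻¹)) := by
    refine (Θ.pullback_congr_sameDivisor ht).trans ?_
    refine (Θ.pullback_pullback_sameDivisor _ _).symm.trans ?_
    refine CartierDivisor.SameDivisor.pullback _ ?_
    refine (Θ.pullback_pullback_sameDivisor _ _).symm.trans ?_
    exact (hΘ σ).pullback _
  -- `-Θ ~ (gal σ⁻¹)^* (-Θ)`
  have h2 : (-Θ).SameDivisor ((-Θ).pullback (P.galX L σ⁻¹)) :=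
    ((hΘ σ⁻¹).symm.neg).trans (CartierDivisor.pullback_neg_sameDivisor _ Θ).symm
  exact (h1.add h2).trans (CartierDivisor.pullback_add_sameDivisor _ _ _).symm

/-- The pullback `pr₁^* Θ₀` of a divisor of `P` is Galois invariant: `(gal τ)^* pr₁^* Θ₀ = pr₁^* Θ₀`
(`gal τ ≫ pr₁ = pr₁`). [folklore] -/
theorem pullback_fstX_galX_sameDivisor (Θ₀ : CartierDivisor P.X.left) (τ : L ≃ₐ[K] L) :
    (((Θ₀.pullback (P.fstX L)).pullback (P.galX L τ)).SameDivisor (Θ₀.pullback (P.fstX L))) := by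
  haveI : IsDominant (P.galX L τ ≫ P.fstX L) := inferInstance
  exact (Θ₀.pullback_pullback_sameDivisor _ _).trans (Θ₀.pullback_congr_sameDivisor (P.galX_fstX L τ))

/-! ### Galois equivariance of `ē_N^Θ` -/

section Level

variable {N : ℕ} [IsDominant (Hom.toSchemeHom ((N : ℤ) • 𝟙 (P.baseChange L)))]

omit [IsDominant (Hom.toSchemeHom ((N : ℤ) • 𝟙 (P.baseChange L)))] in
/-- The `L`-point of `P_L` attached to an `L`-point `s ∈ P(L)` with `s ^ N = 1` is `N`-torsion.
[folklore] -/
theorem pointsMulEquiv_mem_torsionPoints {s : P.Points L} (hs : s ^ N = 1) :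
    P.pointsMulEquiv L s ∈ (P.baseChange L).torsionPoints L N := by
  rw [mem_torsionPoints_iff, zpow_natCast, ← map_pow, hs, map_one]

omit [IsDominant (Hom.toSchemeHom ((N : ℤ) • 𝟙 (P.baseChange L)))] in
/-- Galois conjugation preserves `s ^ N = 1` (the action is by group automorphisms). [folklore] -/
theorem smul_pow_eq_one {s : P.Points L} (σ : L ≃ₐ[K] L) (hs : s ^ N = 1) : (σ • s) ^ N = 1 := by
  rw [AlgPoints.smul_def, ← MonObj.comp_pow, hs]
  exact MonObj.comp_one _

/-- The `N`-torsion point of `P_L(L)` attached to `s ∈ P(L)` with `s ^ N = 1`. [folklore] -/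
abbrev torsionPt {s : P.Points L} (hs : s ^ N = 1) : (P.baseChange L).torsionPoints L N :=
  ⟨P.pointsMulEquiv L s, P.pointsMulEquiv_mem_torsionPoints L hs⟩

/-- **Galois equivariance of the level Weil pairing** (Milne 1986, §16, p. 131: the `ē_m` are
pairings of Galois modules; Lang VII §2; Mumford §20): for a Galois-invariant divisor `Θ` on `P_L`
(`(gal τ)^* Θ = Θ` for all `τ`), `σ ∈ Aut(L/K)` and `r, s ∈ P(L)` with `r^N = s^N = 1`,
`ē_N^Θ(σ r, σ s) = σ (ē_N^Θ(r, s))`. Proof: `(gal σ⁻¹)^♯ g_s` trivializes `[N]^* D_{σ s}`, and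
`t_{σ r}^♯ (gal σ⁻¹)^♯ g_s / (gal σ⁻¹)^♯ g_s = (gal σ⁻¹)^♯ (t_r^♯ g_s / g_s) = (gal σ⁻¹)^♯ ē(r, s) =
σ ē(r, s)` on constants. [cite: Milne1986AbelianVarieties, §16 (p. 131, the pairings ē_m)] -/
theorem weilPairingLevel_galSmul (Θ : CartierDivisor (P.baseChange L).X.left)
    (hΘ : ∀ τ : L ≃ₐ[K] L, (Θ.pullback (P.galX L τ)).SameDivisor Θ) (σ : L ≃ₐ[K] L)
    {r s : P.Points L} (hr : r ^ N = 1) (hs : s ^ N = 1) :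
    (P.baseChange L).weilPairingLevel Θ (P.torsionPt L (P.smul_pow_eq_one L σ hr))
        (P.torsionPt L (P.smul_pow_eq_one L σ hs)) =
      σ ((P.baseChange L).weilPairingLevel Θ (P.torsionPt L hr) (P.torsionPt L hs)) := by
  have hg : (P.baseChange L).IsTrivializer (n := N) ((P.baseChange L).weilDiv Θ (P.pointsMulEquiv L s))
      ((P.baseChange L).weilFn Θ (P.torsionPt L hs)) :=
    (P.baseChange L).isTrivializer_weilFn Θ (P.torsionPt L hs)
  -- the transported trivializer of `[N]^* D_{σ s}`
  have hg' : (P.baseChange L).IsTrivializer (n := N)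
      ((P.baseChange L).weilDiv Θ (P.pointsMulEquiv L (σ • s)))
      (functionFieldMap (P.galX L σ⁻¹) ((P.baseChange L).weilFn Θ (P.torsionPt L hs))) :=
    (hg.gal L P σ⁻¹).of_sameDivisor (P.weilDiv_smul_sameDivisor L Θ hΘ σ s).symm
  rw [weilPairingLevel_eq_kummerConst (Q := P.torsionPt L (P.smul_pow_eq_one L σ hs)) hg'
    (P.torsionPt L (P.smul_pow_eq_one L σ hr))]
  apply (algebraMap L (P.baseChange L).X.left.functionField).injective
  rw [algebraMap_kummerConst]
  -- `t_{σ r}^♯ = (gal σ⁻¹)^♯ ∘ t_r^♯ ∘ (gal σ)^♯`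
  have ht := P.translation_smul_left L σ r
  haveI : IsDominant (((P.baseChange L).translation (P.pointsMulEquiv L r)).left ≫ P.galX L σ) :=
    inferInstance
  haveI : IsDominant (P.galX L σ⁻¹ ≫
      ((P.baseChange L).translation (P.pointsMulEquiv L r)).left ≫ P.galX L σ) := inferInstance
  have hFF : (P.baseChange L).translFF (P.pointsMulEquiv L (σ • r)) =
      (functionFieldMap (P.galX L σ⁻¹)).comp
        (((P.baseChange L).translFF (P.pointsMulEquiv L r)).comp (functionFieldMap (P.galX L σ))) := by
    unfold translFF
    rw [functionFieldMap_congr ht, functionFieldMap_comp, functionFieldMap_comp]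
  have hinv : ∀ f : (P.baseChange L).X.left.functionField,
      (functionFieldMap (P.galX L σ)) ((functionFieldMap (P.galX L σ⁻¹)) f) = f := fun f => by
    haveI : IsDominant (P.galX L σ ≫ P.galX L σ⁻¹) := inferInstance
    rw [← RingHom.comp_apply, ← functionFieldMap_comp,
      functionFieldMap_congr (P.galX_comp_galX_symm L σ), functionFieldMap_id, RingHom.id_apply]
  change (P.baseChange L).translFF (P.pointsMulEquiv L (σ • r))
      (functionFieldMap (P.galX L σ⁻¹) ((P.baseChange L).weilFn Θ (P.torsionPt L hs))) /
      functionFieldMap (P.galX L σ⁻¹) ((P.baseChange L).weilFn Θ (P.torsionPt L hs)) = _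
  rw [hFF, RingHom.comp_apply, RingHom.comp_apply, hinv, ← map_div₀,
    ← algebraMap_kummerConst hg (P.torsionPt L hr), functionFieldMap_galX_algebraMap, inv_inv]
  rfl

end Level

end AbelianVariety

end Literature.AlgebraicGeometry.Motives
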